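import Mathlib.NumberTheory.LegendreSymbol.Basic
import Mathlib.NumberTheory.Padics.PadicVal.Basic
import Mathlib.Algebra.Squarefree.Basic
import Mathlib.Tactic
import HarnessLib

/-!
# Mordell equations `y² = x³ + t` without integral solutions (Cohen, Prop. 6.7.6)

H. Cohen, *Number Theory I* (GTM 239), §6.7.2, Proposition 6.7.6 [Cohen2007NumberTheoryI]: let `a` be odd
and `3 ∤ b`; assume `t = 8a³ − b²` with `b` odd, or `t = a³ − 4b²` with `t ≢ 1 (mod 8)`; if `t` is
squarefree (of any sign) then `y² = x³ + t` has no integral solution. ("A classical example … the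
special case `t = 7` is also due to Fermat"; it disposes e.g. of `t = 7, 11, 13, 23, 39, 47, 53, …`.)
Everything here is a `theorem`; the proof is the printed one.

## The printed proof and this file

* `x` is odd (else `t ≡ y² − x³ ≡ 1 (mod 8)`, resp. `t ≡ −b² ≡ −1`).
* First family: `y² + b² = (x + 2a)((x − a)² + 3a²)`; the second factor is `≡ 3 (mod 4)` and positive,
  so some prime `p ≡ 3 (mod 4)` divides it to an odd power (`exists_prime_odd_padicValNat`); such a
  `p` dividing `y² + b²` divides `y` and `b`, and `p ∤ x + 2a` (else `p ∣ 12a²`, so `p ∣ a` — then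
  `p² ∣ t` — or `p = 3 ∣ b`); hence `v_p(y² + b²)` is odd, while it is always even
  (`even_padicValInt_sq_add_sq`).
* Second family: `y = 2y₁`, `x + a = 4x₁`, `y₁² + b² = x₁(16x₁² − 12ax₁ + 3a²)`, same argument with the
  second factor.

Mathlib: `ZMod.mod_four_ne_three_of_sq_eq_neg_sq'` (a prime `≡ 3 (mod 4)` dividing `y² + b²` divides
both), `padicValInt`/`padicValNat` and their multiplicativity, `Squarefree`. Tree: `lean search
'x \^ 3 \+ 7|Mordell.*no.*integral|sq_eq_cube_add'` finds only the rational-point files for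
`y² = x³ ± 1`, `y² = x³ − 8` (`GeneralizedFermatParabolicCase`, `SixthPowerAddFourthPowerEqSquare`).
-/

namespace Literature.NumberTheory.DiophantineGeometry

namespace MordellQuadraticObstruction

/-! ## Arithmetic lemmas -/

/-- A natural number `m ≡ 3 (mod 4)` has a prime divisor `q ≡ 3 (mod 4)`. [folklore] -/
private theorem exists_prime_dvd_mod_four {m : ℕ} (hm : m % 4 = 3) :
    ∃ q : ℕ, q.Prime ∧ q ∣ m ∧ q % 4 = 3 := by
  induction m using Nat.strong_induction_on with
  | _ m IH =>
    have hm1 : m ≠ 1 := by omega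
    have hqp : m.minFac.Prime := Nat.minFac_prime hm1
    obtain ⟨m', hm'⟩ := Nat.minFac_dvd m
    have hmodd : Odd m := Nat.odd_iff.mpr (by omega)
    have hqodd : Odd m.minFac := hmodd.of_dvd_nat (Nat.minFac_dvd m)
    by_cases hq3 : m.minFac % 4 = 3
    · exact ⟨m.minFac, hqp, Nat.minFac_dvd m, hq3⟩
    · have hq1 : m.minFac % 4 = 1 := by obtain ⟨k, hk⟩ := hqodd; omega
      obtain ⟨k, hk⟩ : ∃ k, m.minFac = 4 * k + 1 := ⟨m.minFac / 4, by omega⟩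
      have e : m = 4 * (k * m') + m' := by rw [hm', hk]; ring
      have hm'3 : m' % 4 = 3 := by omega
      have hm'lt : m' < m := by
        have h2 := hqp.two_le
        have hm'0 : 0 < m' := by
          rcases Nat.eq_zero_or_pos m' with h0 | h0
          · rw [h0, mul_zero] at hm'; omega
          · exact h0
        have hkm : 0 < k * m' := Nat.mul_pos (by omega) hm'0
        omega
      obtain ⟨q, hq, hqm', hq3'⟩ := IH m' hm'lt hm'3
      exact ⟨q, hq, hqm'.trans (Dvd.intro_left _ hm'.symm), hq3'⟩

/-- A natural number `m ≡ 3 (mod 4)` has a prime divisor `p ≡ 3 (mod 4)` dividing it to an odd power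
("since this is a positive number ≡ 3 (mod 4) … there exists a prime `p ≡ 3 (mod 4)` dividing it to an
odd power"). [cite: Cohen2007NumberTheoryI, Prop. 6.7.6 (proof)] -/
theorem exists_prime_odd_padicValNat {m : ℕ} (hm : m % 4 = 3) :
    ∃ p : ℕ, p.Prime ∧ p % 4 = 3 ∧ Odd (padicValNat p m) := by
  induction m using Nat.strong_induction_on with
  | _ m IH =>
    have hm0 : m ≠ 0 := by omega
    obtain ⟨q, hq, hqm, hq3⟩ := exists_prime_dvd_mod_four hm
    haveI := Fact.mk hq
    rcases Nat.even_or_odd (padicValNat q m) with hev | hodd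
    · -- `q² ∣ m`; recurse on `m / q²`
      have h1 : 1 ≤ padicValNat q m := one_le_padicValNat_of_dvd hm0 hqm
      have h2 : 2 ≤ padicValNat q m := by obtain ⟨k, hk⟩ := hev; omega
      have hq2m : q ^ 2 ∣ m := (padicValNat_dvd_iff_le hm0).mpr h2
      obtain ⟨m', hm'⟩ := hq2m
      have hm'0 : m' ≠ 0 := by rintro rfl; rw [mul_zero] at hm'; exact hm0 hm'
      obtain ⟨i, hi⟩ : ∃ i, q = 2 * i + 1 := ⟨q / 2, by omega⟩
      have e : m = 4 * ((i ^ 2 + i) * m') + m' := by rw [hm', hi]; ring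
      have hm'3 : m' % 4 = 3 := by omega
      have hm'lt : m' < m := by
        have : 1 < q ^ 2 := by nlinarith [hq.two_le]
        have : 0 < m' := Nat.pos_of_ne_zero hm'0
        nlinarith
      obtain ⟨p, hp, hp3, hpodd⟩ := IH m' hm'lt hm'3
      haveI := Fact.mk hp
      refine ⟨p, hp, hp3, ?_⟩
      rw [hm', padicValNat.mul (pow_ne_zero _ hq.ne_zero) hm'0, padicValNat.pow q 2]
      exact (even_two_mul _).add_odd hpodd
    · exact ⟨q, hq, hq3, hodd⟩

/-- A prime `p ≡ 3 (mod 4)` dividing `y² + b²` divides `y` and `b` (`(−1/p) = −1`).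
[cite: Cohen2007NumberTheoryI, Prop. 6.7.6 (proof)] -/
theorem dvd_of_dvd_sq_add_sq {p : ℕ} (hp : p.Prime) (hp3 : p % 4 = 3) {y b : ℤ}
    (h : (p : ℤ) ∣ y ^ 2 + b ^ 2) : (p : ℤ) ∣ y ∧ (p : ℤ) ∣ b := by
  haveI := Fact.mk hp
  have hp' : Prime (p : ℤ) := Nat.prime_iff_prime_int.mp hp
  have hb : (p : ℤ) ∣ b := by
    by_contra hb
    have hb0 : (b : ZMod p) ≠ 0 := by rwa [Ne, ZMod.intCast_zmod_eq_zero_iff_dvd]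
    have e : ((y ^ 2 + b ^ 2 : ℤ) : ZMod p) = 0 := (ZMod.intCast_zmod_eq_zero_iff_dvd _ p).mpr h
    push_cast at e
    exact ZMod.mod_four_ne_three_of_sq_eq_neg_sq' (x := (y : ZMod p)) hb0 (by linear_combination e) hp3
  refine ⟨hp'.dvd_of_dvd_pow (n := 2) ?_, hb⟩
  have e : y ^ 2 = (y ^ 2 + b ^ 2) - b ^ 2 := by ring
  rw [e]
  exact dvd_sub h (dvd_pow hb two_ne_zero)

/-- For a prime `p ≡ 3 (mod 4)` and `b ≠ 0`, the `p`-adic valuation of `y² + b²` is even.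
[cite: Cohen2007NumberTheoryI, Prop. 6.7.6 (proof)] -/
theorem even_padicValInt_sq_add_sq {p : ℕ} (hp : p.Prime) (hp3 : p % 4 = 3) :
    ∀ (n : ℕ) (y b : ℤ), b.natAbs = n → b ≠ 0 → Even (padicValInt p (y ^ 2 + b ^ 2)) := by
  haveI := Fact.mk hp
  intro n
  induction n using Nat.strong_induction_on with
  | _ n IH =>
    intro y b hn hb0
    by_cases hdvd : (p : ℤ) ∣ y ^ 2 + b ^ 2
    · obtain ⟨hy, hb⟩ := dvd_of_dvd_sq_add_sq hp hp3 hdvd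
      obtain ⟨y', rfl⟩ := hy
      obtain ⟨b', rfl⟩ := hb
      have hb'0 : b' ≠ 0 := by rintro rfl; exact hb0 (by simp)
      have hp0 : (p : ℤ) ≠ 0 := by exact_mod_cast hp.ne_zero
      have e : ((p : ℤ) * y') ^ 2 + ((p : ℤ) * b') ^ 2 = (p : ℤ) ^ 2 * (y' ^ 2 + b' ^ 2) := by ring
      have hs0 : y' ^ 2 + b' ^ 2 ≠ 0 := by positivity
      have hlt : b'.natAbs < n := by
        rw [← hn, Int.natAbs_mul, Int.natAbs_natCast]
        have : 0 < b'.natAbs := Int.natAbs_pos.mpr hb'0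
        nlinarith [hp.two_le]
      have hIH := IH _ hlt y' b' rfl hb'0
      rw [e, padicValInt.mul (pow_ne_zero _ hp0) hs0]
      have h2 : padicValInt p ((p : ℤ) ^ 2) = 2 := by
        rw [show ((p : ℤ) ^ 2) = ((p ^ 2 : ℕ) : ℤ) by push_cast; ring, padicValInt.of_nat,
          padicValNat.prime_pow]
      rw [h2]
      exact (even_two).add hIH
    · rw [padicValInt.eq_zero_of_not_dvd hdvd]
      exact Even.zero

/-- The valuation bookkeeping common to both families: if `y² + b² = u·m` with `b ≠ 0`, `m > 0`,
`m ≡ 3 (mod 4)`, and every prime `p ≡ 3 (mod 4)` dividing `m` and `b` fails to divide `u`, we get a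
contradiction. [cite: Cohen2007NumberTheoryI, Prop. 6.7.6 (proof)] -/
theorem key_contradiction {y b u m : ℤ} (hb0 : b ≠ 0) (hm0 : 0 < m) (hm3 : m % 4 = 3)
    (hfac : y ^ 2 + b ^ 2 = u * m)
    (hu : ∀ p : ℕ, p.Prime → p % 4 = 3 → (p : ℤ) ∣ m → (p : ℤ) ∣ b → ¬ (p : ℤ) ∣ u) : False := by
  have hmn : m.natAbs % 4 = 3 := by omega
  obtain ⟨p, hp, hp3, hodd⟩ := exists_prime_odd_padicValNat hmn
  haveI := Fact.mk hp
  have hpm : (p : ℤ) ∣ m := by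
    have h1 : p ∣ m.natAbs := dvd_of_one_le_padicValNat (hodd.pos)
    exact Int.natCast_dvd.mpr h1
  have hpyb : (p : ℤ) ∣ y ^ 2 + b ^ 2 := by rw [hfac]; exact dvd_mul_of_dvd_right hpm _
  obtain ⟨-, hpb⟩ := dvd_of_dvd_sq_add_sq hp hp3 hpyb
  have hpu : ¬ (p : ℤ) ∣ u := hu p hp hp3 hpm hpb
  have hu0 : u ≠ 0 := by rintro rfl; exact hpu (dvd_zero _)
  have heven := even_padicValInt_sq_add_sq hp hp3 _ y b rfl hb0
  rw [hfac, padicValInt.mul hu0 hm0.ne', padicValInt.eq_zero_of_not_dvd hpu, zero_add,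
    padicValInt] at heven
  exact Nat.not_even_iff_odd.mpr hodd heven

/-! ## Proposition 6.7.6 -/

/-- Squares modulo 8 bookkeeping for the first family: `x` is odd. [folklore] -/
private theorem zmod4_first : ∀ K Y J A : ZMod 4,
    Y ^ 2 = (2 * K) ^ 3 + (8 * A ^ 3 - (2 * J + 1) ^ 2) → False := by decide

/-- Squares modulo 8 bookkeeping for the second family: `x` even forces `t ≡ 1 (mod 8)`. [folklore] -/
private theorem zmod8_second : ∀ K Y A B : ZMod 8,
    Y ^ 2 = (2 * K) ^ 3 + ((2 * A + 1) ^ 3 - 4 * B ^ 2) → (2 * A + 1) ^ 3 - 4 * B ^ 2 = 1 := by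
  decide

/-- In the second family, `x` odd and `y` odd is impossible (`t` is odd). [folklore] -/
private theorem zmod2_second : ∀ X Y A B : ZMod 2,
    (2 * Y + 1) ^ 2 = (2 * X + 1) ^ 3 + ((2 * A + 1) ^ 3 - 4 * B ^ 2) → False := by decide

/-- A prime dividing a squarefree integer does not divide it twice. [folklore] -/
private theorem not_sq_dvd_of_squarefree {t : ℤ} (ht : Squarefree t) {p : ℕ} (hp : p.Prime) :
    ¬ (p : ℤ) ^ 2 ∣ t := by
  intro h
  have := ht (p : ℤ) (by rw [← pow_two]; exact h)
  rw [Int.isUnit_iff] at this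
  have h2 := hp.two_le
  rcases this with h1 | h1
  · have : (p : ℤ) = 1 := h1; norm_cast at this; omega
  · have : (0 : ℤ) ≤ p := by positivity
    linarith

/-- **Cohen, Prop. 6.7.6, first family.** Let `a` be odd, `b` odd with `3 ∤ b`, and `t = 8a³ − b²`
squarefree. Then `y² = x³ + t` has no integral solution. (Fermat's `t = 7` is `a = b = 1`.)
[cite: Cohen2007NumberTheoryI, Prop. 6.7.6] -/
theorem cohen_prop_6_7_6_i {a b : ℤ} (ha : Odd a) (hb : Odd b) (hb3 : ¬ (3 : ℤ) ∣ b)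
    (ht : Squarefree (8 * a ^ 3 - b ^ 2)) {x y : ℤ} : y ^ 2 ≠ x ^ 3 + (8 * a ^ 3 - b ^ 2) := by
  intro h
  have hb0 : b ≠ 0 := by rintro rfl; exact hb3 (dvd_zero 3)
  -- `x` is odd
  have hx : Odd x := by
    rcases Int.even_or_odd x with ⟨k, hk⟩ | hx
    · exfalso
      obtain ⟨j, hj⟩ := hb
      have e := congrArg (Int.cast : ℤ → ZMod 4) h
      push_cast at e
      rw [hk, hj] at e
      push_cast at e
      exact zmod4_first k y j a (by rw [← two_mul] at e; linear_combination e)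
    · exact hx
  -- `y² + b² = (x + 2a)((x − a)² + 3a²)`
  set m : ℤ := (x - a) ^ 2 + 3 * a ^ 2 with hm
  have hfac : y ^ 2 + b ^ 2 = (x + 2 * a) * m := by rw [hm]; linear_combination h
  have hm0 : 0 < m := by
    have ha0 : a ≠ 0 := by rintro rfl; exact (Int.not_even_iff_odd.mpr ha) Even.zero
    positivity
  have hm3 : m % 4 = 3 := by
    obtain ⟨k, hk⟩ := ha
    obtain ⟨l, hl⟩ := hx
    have e : m = 4 * ((l - k) ^ 2 + 3 * (k ^ 2 + k)) + 3 := by rw [hm, hk, hl]; ring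
    omega
  refine key_contradiction hb0 hm0 hm3 hfac fun p hp hp3 hpm hpb hpu => ?_
  -- `p ∣ x + 2a` and `p ∣ m = (x+2a)(x−4a) + 12a²` give `p ∣ 12a²`
  have hp' : Prime (p : ℤ) := Nat.prime_iff_prime_int.mp hp
  have h12 : (p : ℤ) ∣ 12 * a ^ 2 := by
    have e : 12 * a ^ 2 = m - (x + 2 * a) * (x - 4 * a) := by rw [hm]; ring
    rw [e]
    exact dvd_sub hpm (dvd_mul_of_dvd_left hpu _)
  rcases hp'.dvd_or_dvd h12 with h12' | ha2
  · -- `p ∣ 12`, `p ≡ 3 (mod 4)` ⇒ `p = 3` ⇒ `3 ∣ b`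
    have hp12 : p ∣ 12 := by exact_mod_cast h12'
    have hp3' : p = 3 := by
      have := Nat.le_of_dvd (by norm_num) hp12
      interval_cases p <;> simp_all
    subst hp3'
    exact hb3 (by exact_mod_cast hpb)
  · -- `p ∣ a` ⇒ `p² ∣ 8a³ − b²`
    have hpa : (p : ℤ) ∣ a := hp'.dvd_of_dvd_pow ha2
    have h1 : (p : ℤ) ^ 2 ∣ 8 * a ^ 3 :=
      Dvd.dvd.mul_left ((pow_dvd_pow_of_dvd hpa 2).trans (pow_dvd_pow a (by norm_num))) 8
    have h2 : (p : ℤ) ^ 2 ∣ b ^ 2 := pow_dvd_pow_of_dvd hpb 2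
    exact not_sq_dvd_of_squarefree ht hp (dvd_sub h1 h2)

/-- **Fermat / Cohen Prop. 6.7.6:** `y² = x³ + 7` has no solution in integers (`a = b = 1`).
[cite: Cohen2007NumberTheoryI, Prop. 6.7.6 (t = 7)] -/
theorem sq_ne_cube_add_seven (x y : ℤ) : y ^ 2 ≠ x ^ 3 + 7 := by
  have h := cohen_prop_6_7_6_i (a := 1) (b := 1) odd_one odd_one (by decide) (by norm_num)
    (x := x) (y := y)
  norm_num at h
  exact h

/-- **Cohen, Prop. 6.7.6, second family.** Let `a` be odd, `3 ∤ b`, `t = a³ − 4b²` with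
`t ≢ 1 (mod 8)` and `t` squarefree. Then `y² = x³ + t` has no integral solution.
[cite: Cohen2007NumberTheoryI, Prop. 6.7.6] -/
theorem cohen_prop_6_7_6_ii {a b : ℤ} (ha : Odd a) (hb3 : ¬ (3 : ℤ) ∣ b)
    (ht8 : (a ^ 3 - 4 * b ^ 2) % 8 ≠ 1) (ht : Squarefree (a ^ 3 - 4 * b ^ 2)) {x y : ℤ} :
    y ^ 2 ≠ x ^ 3 + (a ^ 3 - 4 * b ^ 2) := by
  intro h
  have hb0 : b ≠ 0 := by rintro rfl; exact hb3 (dvd_zero 3)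
  obtain ⟨k, hk⟩ := ha
  -- `x` is odd
  have hx : Odd x := by
    rcases Int.even_or_odd x with ⟨l, hl⟩ | hx
    · exfalso
      have e := congrArg (Int.cast : ℤ → ZMod 8) h
      push_cast at e
      rw [hl, hk] at e
      push_cast at e
      have h1 := zmod8_second l y k b (by rw [← two_mul] at e; linear_combination e)
      apply ht8
      have h2 : (((a ^ 3 - 4 * b ^ 2 - 1 : ℤ)) : ZMod 8) = 0 := by
        push_cast; rw [hk]; push_cast; linear_combination h1
      rw [ZMod.intCast_zmod_eq_zero_iff_dvd] at h2
      have h8 : ((8 : ℕ) : ℤ) = 8 := by norm_num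
      rw [h8] at h2
      omega
    · exact hx
  obtain ⟨l, hl⟩ := hx
  -- `y` is even
  have hy : Even y := by
    rcases Int.even_or_odd y with hy | ⟨j, hj⟩
    · exact hy
    · exfalso
      have e := congrArg (Int.cast : ℤ → ZMod 2) h
      push_cast at e
      rw [hl, hk, hj] at e
      push_cast at e
      exact zmod2_second l j k b (by linear_combination e)
  obtain ⟨y₁, hy₁⟩ := hy
  -- `x + a = 4 x₁`
  have h4 : (4 : ℤ) ∣ x + a := by
    have h1 : (4 : ℤ) ∣ (x + a) * (x ^ 2 - x * a + a ^ 2) := by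
      refine ⟨y₁ ^ 2 + b ^ 2, ?_⟩
      rw [hy₁] at h
      linear_combination -h
    have hodd : Odd (x ^ 2 - x * a + a ^ 2) :=
      ⟨2 * l ^ 2 + l - 2 * l * k + k + 2 * k ^ 2, by rw [hl, hk]; ring⟩
    have hcop : IsCoprime (4 : ℤ) (x ^ 2 - x * a + a ^ 2) := by
      have : IsCoprime (2 : ℤ) (x ^ 2 - x * a + a ^ 2) := Int.isCoprime_two_left.mpr hodd
      simpa using this.pow_left (m := 2)
    exact hcop.dvd_of_dvd_mul_right h1
  obtain ⟨x₁, hx₁⟩ := h4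
  set m : ℤ := 16 * x₁ ^ 2 - 12 * a * x₁ + 3 * a ^ 2 with hm
  have hfac : y₁ ^ 2 + b ^ 2 = x₁ * m := by
    have hx' : x = 4 * x₁ - a := by linear_combination hx₁
    have e : (y₁ + y₁) ^ 2 = x ^ 3 + (a ^ 3 - 4 * b ^ 2) := by rw [← hy₁]; exact h
    rw [hx'] at e
    have e4 : (4 : ℤ) * (y₁ ^ 2 + b ^ 2) = 4 * (x₁ * m) := by rw [hm]; linear_combination e
    exact mul_left_cancel₀ (by norm_num) e4
  have hm0 : 0 < m := by
    have ha0 : a ≠ 0 := by rintro rfl; omega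
    have : 0 < a ^ 2 := by positivity
    nlinarith [sq_nonneg (8 * x₁ - 3 * a)]
  have hm3 : m % 4 = 3 := by
    have e : m = 4 * (4 * x₁ ^ 2 - 3 * a * x₁ + 3 * (k ^ 2 + k)) + 3 := by rw [hm, hk]; ring
    omega
  refine key_contradiction hb0 hm0 hm3 hfac fun p hp hp3 hpm hpb hpu => ?_
  have hp' : Prime (p : ℤ) := Nat.prime_iff_prime_int.mp hp
  have h3a : (p : ℤ) ∣ 3 * a ^ 2 := by
    have e : 3 * a ^ 2 = m - x₁ * (16 * x₁ - 12 * a) := by rw [hm]; ring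
    rw [e]
    exact dvd_sub hpm (dvd_mul_of_dvd_left hpu _)
  rcases hp'.dvd_or_dvd h3a with h3 | ha2
  · have hp3d : p ∣ 3 := by exact_mod_cast h3
    have hp3' : p = 3 := (Nat.prime_dvd_prime_iff_eq hp Nat.prime_three).mp hp3d
    subst hp3'
    exact hb3 (by exact_mod_cast hpb)
  · have hpa : (p : ℤ) ∣ a := hp'.dvd_of_dvd_pow ha2
    have h1 : (p : ℤ) ^ 2 ∣ a ^ 3 := (pow_dvd_pow_of_dvd hpa 2).trans (pow_dvd_pow a (by norm_num))
    have h2 : (p : ℤ) ^ 2 ∣ 4 * b ^ 2 := Dvd.dvd.mul_left (pow_dvd_pow_of_dvd hpb 2) 4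
    exact not_sq_dvd_of_squarefree ht hp (dvd_sub h1 h2)

/-- **Cohen Prop. 6.7.6, `t = 11`:** `y² = x³ + 11` has no solution in integers
(`11 = 3³ − 4·2²`). [cite: Cohen2007NumberTheoryI, Prop. 6.7.6 (t = 11)] -/
theorem sq_ne_cube_add_eleven (x y : ℤ) : y ^ 2 ≠ x ^ 3 + 11 := by
  have h := cohen_prop_6_7_6_ii (a := 3) (b := 2) ⟨1, by norm_num⟩ (by decide) (by decide)
    (by norm_num) (x := x) (y := y)
  norm_num at h
  exact h

/-- **Cohen Prop. 6.7.6, `t = 13`:** `y² = x³ + 13` has no solution in integers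
(`13 = 17³ − 4·35²`, `3 ∤ 35`). [cite: Cohen2007NumberTheoryI, Prop. 6.7.6 (t = 13)] -/
theorem sq_ne_cube_add_thirteen (x y : ℤ) : y ^ 2 ≠ x ^ 3 + 13 := by
  have h := cohen_prop_6_7_6_ii (a := 17) (b := 35) ⟨8, by norm_num⟩ (by decide) (by decide)
    (by norm_num) (x := x) (y := y)
  norm_num at h
  exact h

end MordellQuadraticObstruction

end Literature.NumberTheory.DiophantineGeometry
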